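import Literature.AlgebraicGeometry.Morphisms.GenericFibreSmooth
import Literature.AlgebraicGeometry.Limits.GenericFibreSpread
import Literature.AlgebraicGeometry.Resolution.SmoothLocusBaseChange
import Mathlib.AlgebraicGeometry.Noetherian
import HarnessLib

/-!
# Spreading out from the generic point: generic smoothness over a Noetherian integral affine base

Topic: `Literature/AlgebraicGeometry/Limits` (EGA IV₃ §§8–9, IV₄ 17.7.8; continues
`GenericFibreSpread.lean`). **A morphism of finite type `f : X → Spec B` over a Noetherian
domain `B` whose generic fibre is smooth is smooth over a dense open `D(b)`, `b ≠ 0`**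
(`exists_basicOpen_smooth_morphismRestrict`). The tree's
`Literature/AlgebraicGeometry/Morphisms/GenericFibreSmooth.lean` proves this for `f` universally
closed over any integral base (the bad locus `f(X ∖ sm(X/Y))` is then closed); here the closedness
of `f` is replaced by CHEVALLEY's theorem: `X` is Noetherian, so the closed set `X ∖ sm(X/Y)` is
constructible (`isConstructible_of_isClosed`), its image is constructible, misses the generic
point because every point over it is smooth (`mem_smoothLocus_of_apply_eq_genericPoint`), hence
misses a basic open `D(b)` (`exists_basicOpen_disjoint_image`), over which `f` is smooth
(`smooth_morphismRestrict_of_preimage_le_smoothLocus`). This is the form needed to spread a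
resolution given over the fraction field of `B` (smooth = regular centres in characteristic
zero) to smooth families over `B[1/b]`, whose fibres are then smooth, hence regular.

* `isNoetherian_of_locallyOfFiniteType` — `X` is Noetherian when `f` is locally of finite type
  and quasi-compact and `B` is Noetherian [folklore];
* `isConstructible_of_isClosed` — closed subsets of a Noetherian scheme are constructible
  (every open is quasi-compact) [folklore];
* `exists_basicOpen_forall_mem_smoothLocus`, `exists_basicOpen_smooth_morphismRestrict` — the
  statement [EGA IV₄ 17.7.8 (ii) in the elementary "generic fibre" form];
* `smooth_pullback_snd_of_forall_mem_smoothLocus` — hence the fibres `X ×_B Spec k → Spec k` at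
  the field-valued points of `D(b)` are smooth (smooth locus and base change,
  `Literature/AlgebraicGeometry/Resolution/SmoothLocusBaseChange.lean`).

## References

* A. Grothendieck, J. Dieudonné, EGA IV₄ (1967), 17.7.8, 17.8.2; IV₁ 1.8.4 (Chevalley).
* The Stacks Project, Tags 01V9, 054K.
-/

noncomputable section

universe u

open CategoryTheory CategoryTheory.Limits AlgebraicGeometry TopologicalSpace Topology
  PrimeSpectrum Literature.AlgebraicGeometry.Morphisms

namespace Literature.AlgebraicGeometry.Limits

variable {X : Scheme.{u}}

/-- A scheme locally of finite type and quasi-compact over the spectrum of a Noetherian ring is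
Noetherian. [folklore] -/
theorem isNoetherian_of_locallyOfFiniteType {B : Type u} [CommRing B] [IsNoetherianRing B]
    (f : X ⟶ Spec (CommRingCat.of B)) [LocallyOfFiniteType f] [QuasiCompact f] :
    IsNoetherian X := by
  haveI : IsLocallyNoetherian X := LocallyOfFiniteType.isLocallyNoetherian f
  haveI : CompactSpace X := QuasiCompact.compactSpace_of_compactSpace f
  exact {}

/-- In a Noetherian scheme every closed subset is constructible (its open complement is
quasi-compact, i.e. retrocompact). [folklore] -/
theorem isConstructible_of_isClosed [IsNoetherian X] {Z : Set X} (hZ : IsClosed Z) :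
    IsConstructible Z := by
  rw [← compl_compl Z]
  refine (IsRetrocompact.isConstructible hZ.isOpen_compl ?_).compl
  intro U _ _
  exact NoetherianSpace.isCompact _

/-- **The smooth locus contains the preimage of a dense open.** Let `B` be a Noetherian domain
and `f : X → Spec B` locally of finite presentation and quasi-compact, with smooth generic fibre
`X_η → Spec κ(η)`. Then for some `b ≠ 0` every point of `X` over `D(b)` lies in the smooth locus
`sm(X/B)` of `f`. [cite: StacksProject, Tag 01V9] -/
theorem exists_basicOpen_forall_mem_smoothLocus {B : Type u} [CommRing B] [IsDomain B]
    [IsNoetherianRing B] (f : X ⟶ Spec (CommRingCat.of B)) [LocallyOfFinitePresentation f]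
    [QuasiCompact f]
    (hsm : Smooth (f.fiberToSpecResidueField (genericPoint (Spec (CommRingCat.of B))))) :
    ∃ b : B, b ≠ 0 ∧ ∀ x : X, f x ∈ (PrimeSpectrum.basicOpen b : Set (PrimeSpectrum B)) →
      x ∈ f.smoothLocus := by
  haveI : IsNoetherian X := isNoetherian_of_locallyOfFiniteType f
  -- the non-smooth locus is a constructible closed set whose image misses the generic point
  have hZ : IsConstructible ((f.smoothLocus : Set X)ᶜ) :=
    isConstructible_of_isClosed f.smoothLocus.isOpen.isClosed_compl
  have h0 : (⊥ : PrimeSpectrum B) ∉ f '' (f.smoothLocus : Set X)ᶜ := by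
    rintro ⟨x, hx, hxb⟩
    refine hx (mem_smoothLocus_of_apply_eq_genericPoint f hsm ?_)
    rw [genericPoint_eq_bot_of_affine]
    exact hxb
  obtain ⟨b, hb, hdisj⟩ := exists_basicOpen_disjoint_image f hZ h0
  refine ⟨b, hb, fun x hx => ?_⟩
  by_contra hxs
  exact Set.disjoint_left.mp hdisj hx ⟨x, hxs, rfl⟩

/-- **Generic smoothness over a Noetherian integral affine base.** Let `B` be a Noetherian
domain and `f : X → Spec B` locally of finite presentation and quasi-compact, with smooth
generic fibre `X_η → Spec κ(η)`. Then `f⁻¹(D(b)) → D(b)` is smooth for some `b ≠ 0`.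
[cite: StacksProject, Tag 01V9] -/
theorem exists_basicOpen_smooth_morphismRestrict {B : Type u} [CommRing B] [IsDomain B]
    [IsNoetherianRing B] (f : X ⟶ Spec (CommRingCat.of B)) [LocallyOfFinitePresentation f]
    [QuasiCompact f]
    (hsm : Smooth (f.fiberToSpecResidueField (genericPoint (Spec (CommRingCat.of B))))) :
    ∃ b : B, b ≠ 0 ∧ Smooth (f ∣_ PrimeSpectrum.basicOpen b) := by
  obtain ⟨b, hb, h⟩ := exists_basicOpen_forall_mem_smoothLocus f hsm
  exact ⟨b, hb, smooth_morphismRestrict_of_preimage_le_smoothLocus f _ fun x hx => h x hx⟩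

/-- **The fibres over the field-valued points of `D(b)` are smooth**: if every point of `X` over
`D(b)` is in the smooth locus of `f` (e.g. `b` as in `exists_basicOpen_forall_mem_smoothLocus`),
then for every field-valued point `φ : B → k` with `φ b ≠ 0` the fibre `X ×_{Spec B} Spec k →
Spec k` is smooth (the smooth locus only grows under base change,
`Scheme.Hom.preimage_smoothLocus_le_smoothLocus_pullback_snd`). [folklore] -/
theorem smooth_pullback_snd_of_forall_mem_smoothLocus {B : Type u} [CommRing B]
    (f : X ⟶ Spec (CommRingCat.of B)) [LocallyOfFinitePresentation f] {b : B}
    (h : ∀ x : X, f x ∈ (PrimeSpectrum.basicOpen b : Set (PrimeSpectrum B)) → x ∈ f.smoothLocus)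
    {k : Type u} [Field k] (φ : B →+* k) (hφ : φ b ≠ 0) :
    Smooth (pullback.snd f (Spec.map (CommRingCat.ofHom φ))) := by
  rw [← Scheme.Hom.smoothLocus_eq_top_iff, ← top_le_iff]
  intro z _
  refine Literature.AlgebraicGeometry.Resolution.Scheme.Hom.preimage_smoothLocus_le_smoothLocus_pullback_snd
    f (Spec.map (CommRingCat.ofHom φ)) (h _ ?_)
  have e : f (pullback.fst f (Spec.map (CommRingCat.ofHom φ)) z) =
      Spec.map (CommRingCat.ofHom φ) (pullback.snd f (Spec.map (CommRingCat.ofHom φ)) z) := by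
    rw [← Scheme.Hom.comp_apply, ← Scheme.Hom.comp_apply, pullback.condition]
  rw [e]
  exact (specMap_mem_basicOpen_iff φ b _).mpr hφ

end Literature.AlgebraicGeometry.Limits

end
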